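import Summits.CriticalPhenomena.PercolationContinuityZ3.Theorems.Transplant.FKConnectivityAllQForestAdjacentGuard
import Summits.CriticalPhenomena.PercolationContinuityZ3.Theorems.Transplant.FKConnectivityAllQSPGluing
import Summits.CriticalPhenomena.PercolationContinuityZ3.Theorems.Transplant.FKConnectivityAllQForestAdjacentSlice
import Summits.CriticalPhenomena.PercolationContinuityZ3.Theorems.Transplant.FKConnectivityAllQCountReweightedTrees
import HarnessLib

/-!
# The square-free adjacent forest Rayleigh inequality is an EQUALITY across a cut vertex (forest factorisation over a one-point interface)

Support file (`--supports stmt-CriticalPhenomena-4575`), FK sub-lane `prim-bschramm-fk-1` (gen 18) of the post-continuity programme;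
builds on p205010 (kernel theorem, internal audit signed; external expert review pending).  No definitions, no named facts, no sorries;
standard axioms.

THE NODE (`AdjForestRayleighNoSqOn`, `…TwoClusterRayleighNoSq.lean`): `#(Fo ∩ {e,f ∈ ω}, Fo) ≤ #(Fo ∩ {e ∈ ω}, Fo ∩ {f ∈ ω})` on every fibre,
`e = ov ≠ f = oy` — negative correlation of the colours of two edges at a common vertex in a uniform 2-colouring of the edges into two
forests (memo bschramm/FROM-fk-1-g18-VERTEX-NC.md §1).  THIS FILE: the first structural EQUALITY case in the kernel.
* **`isForestCfg_union_iff_of_cutVertex`**: if the pairs of `E₁` live on `V₁`, those of `E₂` on `V₂`, `V₁ ∩ V₂ ⊆ {m}` and `E₁ ∩ E₂ = ∅`,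
  then for `ω₁ ⊆ E₁`, `ω₂ ⊆ E₂`: `ω₁ ∪ ω₂ ∈ Fo ↔ ω₁ ∈ Fo ∧ ω₂ ∈ Fo` — a cycle cannot cross a one-point interface; proved by COUNTING
  (`ω ∈ Fo ↔ |ω| + k(ω) = |V|`, g16's `isForestCfg_iff_ncard_add`, and fk-2 g7's `clusterCount_series`: `k(ω₁ ∪ ω₂) + |V| = k(ω₁) + k(ω₂)`),
  no walk surgery; **`isForestCfg_iff_inter_of_cutVertex`** (the
  same for `X ⊆ E₁ ∪ E₂` split as `(X ∩ E₁) ∪ (X ∩ E₂)`);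
* **`adjForestNoSq_fibre_eq_of_cutVertex`**: if the whole fibre `(M ∪ {e,f}, u₀)` lives on `E₁ ∪ E₂` as above with `V₁ ∩ V₂ ⊆ {o}`,
  `e ∈ E₁` and `f ∈ E₂` (so `o` separates `v` from `y`), then **`bad = good`**: the involution `ω ↦ ω ∆ (M' ∩ E₂)` (recolour the far side
  of the cut vertex by its partner) exchanges `{e, f ∈ ω}` with `{e ∈ ω, f ∈ ω ∆ M'}` and preserves the two forest conditions side by side.
This is §1(e) of the memo (the swap involution on the component of `v` in `G − o`); with the 2-sum identities and the tight-set decoupling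
(memo §4b–§4c, paper) it belongs to the reductions showing that a minimal counterexample to the node is 3-connected and Laman-sparse.
[cite: SempleWelsh2008, Conj. 1.1 (p. 2)] [cite: CibulkaHladkyLaCroixWagner2008, Thm. 1 (p. 2)] [cite: Linusson2011, Prop. 2.6]
[cite: Grimmett2006, §1.5 (p. 13); §3.8 (pp. 61–62)]
-/

noncomputable section

namespace Summit.CriticalPhenomena.PercolationContinuityZ3.Theorems

namespace FK

open Set Literature.Probability.LatticeModels Literature.Probability.Percolation
open scoped Classical symmDiff

variable {V : Type*} [Fintype V]

/-! ### Forests by counting, and the one-point interface -/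

section CutVertex

variable {E₁ E₂ : Set (Sym2 V)} {V₁ V₂ : Set V} {m : V}

/-- **Forest factorisation across a one-point interface**: with the pairs of `E₁` on `V₁`, those of `E₂` on `V₂`, `V₁ ∩ V₂ ⊆ {m}` and
`E₁, E₂` disjoint, `ω₁ ∪ ω₂ ∈ Fo ↔ ω₁ ∈ Fo ∧ ω₂ ∈ Fo` for `ω₁ ⊆ E₁`, `ω₂ ⊆ E₂` (by `k(ω₁ ∪ ω₂) + |V| = k(ω₁) + k(ω₂)`).
[cite: Grimmett2006, §1.5 (p. 13); §3.8 (pp. 61–62)] -/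
theorem isForestCfg_union_iff_of_cutVertex (h₁ : ∀ e ∈ E₁, ∀ z ∈ e, z ∈ V₁) (h₂ : ∀ e ∈ E₂, ∀ z ∈ e, z ∈ V₂) (hS : V₁ ∩ V₂ ⊆ {m})
    (hd : Disjoint E₁ E₂) {ω₁ ω₂ : BondConfig V} (hω₁ : ω₁ ⊆ E₁) (hω₂ : ω₂ ⊆ E₂) :
    IsForestCfg (ω₁ ∪ ω₂) ↔ IsForestCfg ω₁ ∧ IsForestCfg ω₂ := by
  refine ⟨fun h => ⟨isForestCfg_of_subset h subset_union_left, isForestCfg_of_subset h subset_union_right⟩, fun ⟨hF₁, hF₂⟩ => ?_⟩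
  have hdisj : Disjoint ω₁ ω₂ := Set.disjoint_of_subset hω₁ hω₂ hd
  rw [isForestCfg_iff_ncard_add] at hF₁ hF₂ ⊢
  have hk := clusterCount_series h₁ h₂ hS hω₁ hω₂
  rw [Set.ncard_union_eq hdisj]
  omega

/-- The same for one configuration `X ⊆ E₁ ∪ E₂`, split as `(X ∩ E₁) ∪ (X ∩ E₂)`. [cite: Grimmett2006, §3.8 (pp. 61–62)] -/
theorem isForestCfg_iff_inter_of_cutVertex (h₁ : ∀ e ∈ E₁, ∀ z ∈ e, z ∈ V₁) (h₂ : ∀ e ∈ E₂, ∀ z ∈ e, z ∈ V₂) (hS : V₁ ∩ V₂ ⊆ {m})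
    (hd : Disjoint E₁ E₂) {X : BondConfig V} (hX : X ⊆ E₁ ∪ E₂) :
    IsForestCfg X ↔ IsForestCfg (X ∩ E₁) ∧ IsForestCfg (X ∩ E₂) := by
  have hsplit : X = (X ∩ E₁) ∪ (X ∩ E₂) := by
    rw [← inter_union_distrib_left, inter_eq_self_of_subset_left hX]
  conv_lhs => rw [hsplit]
  exact isForestCfg_union_iff_of_cutVertex h₁ h₂ hS hd inter_subset_right inter_subset_right

end CutVertex

/-! ### Equality across a cut vertex -/

section Equality

variable {E₁ E₂ : Set (Sym2 V)} {V₁ V₂ : Set V} {M u₀ : BondConfig V} {o v y : V}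

omit [Fintype V] in
/-- `(ω ∆ N) ∖ M' = ω ∖ M'` for `N ⊆ M'`. [folklore] -/
theorem symmDiff_sdiff_eq_of_subset {ω N M' : BondConfig V} (hN : N ⊆ M') : (ω ∆ N) \ M' = ω \ M' := by
  ext x
  simp only [mem_sdiff, Set.mem_symmDiff]
  constructor
  · rintro ⟨h | h, hx⟩
    · exact ⟨h.1, hx⟩
    · exact absurd (hN h.1) hx
  · rintro ⟨hx, hxM⟩
    exact ⟨Or.inl ⟨hx, fun h => hxM (hN h)⟩, hxM⟩

omit [Fintype V] in
/-- `(ω ∆ N) ∆ M' = ω ∆ (M' ∖ N)` for `N ⊆ M'`. [folklore] -/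
theorem symmDiff_symmDiff_eq_of_subset {ω N M' : BondConfig V} (hN : N ⊆ M') : (ω ∆ N) ∆ M' = ω ∆ (M' \ N) := by
  ext x
  simp only [mem_sdiff, Set.mem_symmDiff]
  by_cases hxN : x ∈ N
  · have hxM : x ∈ M' := hN hxN
    tauto
  · tauto

/-- **The transfer step**: on a fibre `(M', u₀)` living on `E₁ ∪ E₂` (one-point interface), recolouring the `E₂`-side by its partner,
`ω ↦ ω ∆ (M' ∩ E₂)`, keeps both the configuration and its partner forests. [cite: Grimmett2006, §3.8 (pp. 61–62)] [cite: Linusson2011, Prop. 2.6] -/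
theorem forest_pair_symmDiff_of_cutVertex (h₁ : ∀ e ∈ E₁, ∀ z ∈ e, z ∈ V₁) (h₂ : ∀ e ∈ E₂, ∀ z ∈ e, z ∈ V₂) (hS : V₁ ∩ V₂ ⊆ {o})
    (hd : Disjoint E₁ E₂) {M' : BondConfig V} (hM' : M' ∪ u₀ ⊆ E₁ ∪ E₂) {ω : BondConfig V} (hω : ω \ M' = u₀)
    (hF : IsForestCfg ω) (hFB : IsForestCfg (ω ∆ M')) :
    IsForestCfg (ω ∆ (M' ∩ E₂)) ∧ IsForestCfg ((ω ∆ (M' ∩ E₂)) ∆ M') := by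
  have hωsub : ω ⊆ E₁ ∪ E₂ := fun x hx => by
    by_cases hxM : x ∈ M'
    · exact hM' (Or.inl hxM)
    · exact hM' (Or.inr (hω ▸ ⟨hx, hxM⟩))
  have hM'sub : M' ⊆ E₁ ∪ E₂ := fun x hx => hM' (Or.inl hx)
  set N : BondConfig V := M' ∩ E₂ with hN
  have hY : ω ∆ N ⊆ E₁ ∪ E₂ := by
    intro x hx; rw [Set.mem_symmDiff] at hx
    rcases hx with ⟨hx, -⟩ | ⟨hx, -⟩
    · exact hωsub hx
    · exact hM'sub hx.1
  have hZ : (ω ∆ N) ∆ M' ⊆ E₁ ∪ E₂ := by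
    intro x hx; rw [Set.mem_symmDiff] at hx
    rcases hx with ⟨hx, -⟩ | ⟨hx, -⟩
    · exact hY hx
    · exact hM'sub hx
  have hE : ∀ x, x ∈ E₁ → x ∉ E₂ := fun x hx1 hx2 => Set.disjoint_left.1 hd hx1 hx2
  -- the four side-restrictions are sub-configurations of `ω` or of `ω ∆ M'`
  have hY₁ : (ω ∆ N) ∩ E₁ ⊆ ω := by
    rintro x ⟨hx, hx1⟩; rw [Set.mem_symmDiff] at hx
    rcases hx with ⟨hx, -⟩ | ⟨hx, -⟩
    · exact hx
    · exact absurd hx.2 (hE x hx1)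
  have hY₂ : (ω ∆ N) ∩ E₂ ⊆ ω ∆ M' := by
    rintro x ⟨hx, hx2⟩; rw [Set.mem_symmDiff] at hx ⊢
    rcases hx with ⟨hx, hxN⟩ | ⟨hxN, hx⟩
    · exact Or.inl ⟨hx, fun h => hxN ⟨h, hx2⟩⟩
    · exact Or.inr ⟨hxN.1, hx⟩
  have hZ₁ : ((ω ∆ N) ∆ M') ∩ E₁ ⊆ ω ∆ M' := by
    rintro x ⟨hx, hx1⟩
    have hxN : x ∉ N := fun h => hE x hx1 h.2
    rw [Set.mem_symmDiff] at hx ⊢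
    rcases hx with ⟨hx, hxM⟩ | ⟨hxM, hx⟩
    · rw [Set.mem_symmDiff] at hx
      rcases hx with ⟨hx, -⟩ | ⟨h, -⟩
      · exact Or.inl ⟨hx, hxM⟩
      · exact absurd h hxN
    · refine Or.inr ⟨hxM, fun h => hx ?_⟩
      rw [Set.mem_symmDiff]; exact Or.inl ⟨h, hxN⟩
  have hZ₂ : ((ω ∆ N) ∆ M') ∩ E₂ ⊆ ω := by
    rintro x ⟨hx, hx2⟩
    rw [Set.mem_symmDiff] at hx
    rcases hx with ⟨hx, hxM⟩ | ⟨hxM, hx⟩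
    · rw [Set.mem_symmDiff] at hx
      rcases hx with ⟨hx, -⟩ | ⟨h, -⟩
      · exact hx
      · exact absurd h.1 hxM
    · by_contra hxω
      exact hx (Set.mem_symmDiff.2 (Or.inr ⟨⟨hxM, hx2⟩, hxω⟩))
  refine ⟨(isForestCfg_iff_inter_of_cutVertex h₁ h₂ hS hd hY).2 ⟨isForestCfg_of_subset hF hY₁, isForestCfg_of_subset hFB hY₂⟩,
    (isForestCfg_iff_inter_of_cutVertex h₁ h₂ hS hd hZ).2 ⟨isForestCfg_of_subset hFB hZ₁, isForestCfg_of_subset hF hZ₂⟩⟩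

/-- **The node's inequality is an EQUALITY across a cut vertex.**  Fibre `(M ∪ {e,f}, u₀)`, `e = ov`, `f = oy` outside `M ∪ u₀`, all pairs
of the fibre living on `E₁ ∪ E₂` with the pairs of `E_i` on `V_i`, `V₁ ∩ V₂ ⊆ {o}`, `E₁ ∩ E₂ = ∅`, `e ∈ E₁`, `f ∈ E₂` (`o` separates `v`
from `y`): `#(Fo ∩ {e, f ∈ ω}, Fo) = #(Fo ∩ {e ∈ ω}, Fo ∩ {f ∈ ω})`. [cite: SempleWelsh2008, Conj. 1.1 (p. 2)] [cite: Linusson2011, Prop. 2.6]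
[cite: Grimmett2006, §3.8 (pp. 61–62)] -/
theorem adjForestNoSq_fibre_eq_of_cutVertex (h₁ : ∀ e ∈ E₁, ∀ z ∈ e, z ∈ V₁) (h₂ : ∀ e ∈ E₂, ∀ z ∈ e, z ∈ V₂) (hS : V₁ ∩ V₂ ⊆ {o})
    (hd : Disjoint E₁ E₂) (heE : s(o, v) ∈ E₁) (hfE : s(o, y) ∈ E₂)
    (hsub : insert s(o, y) (insert s(o, v) M) ∪ u₀ ⊆ E₁ ∪ E₂) :
    fibreCount (insert s(o, y) (insert s(o, v) M)) u₀ (forestEv V ∩ {ω | s(o, v) ∈ ω ∧ s(o, y) ∈ ω}) (forestEv V) =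
      fibreCount (insert s(o, y) (insert s(o, v) M)) u₀ (forestEv V ∩ {ω | s(o, v) ∈ ω}) (forestEv V ∩ {ω | s(o, y) ∈ ω}) := by
  set M' : BondConfig V := insert s(o, y) (insert s(o, v) M) with hM'
  set N : BondConfig V := M' ∩ E₂ with hN
  have hNM : N ⊆ M' := inter_subset_left
  have heN : s(o, v) ∉ N := fun h => Set.disjoint_left.1 hd heE h.2
  have hfN : s(o, y) ∈ N := ⟨mem_insert _ _, hfE⟩
  have hfD : s(o, y) ∉ M' \ N := fun h => h.2 hfN
  have hback : ∀ ω : BondConfig V, (ω ∆ N) ∆ N = ω := fun ω => symmDiff_symmDiff_cancel_right _ _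
  refine fibreCount_eq_of_bij (fun ω => ω ∆ N) (fun ω => ω ∆ N) (fun ω hω hA hB => ?_) (fun ω hω hA hB => ?_)
  · -- bad ↦ good
    obtain ⟨hF, he, hf⟩ := hA
    have hF' : IsForestCfg ω := hF
    have hFB : IsForestCfg (ω ∆ M') := hB
    obtain ⟨hF1, hF2⟩ := forest_pair_symmDiff_of_cutVertex h₁ h₂ hS hd hsub hω hF' hFB
    refine ⟨by rw [symmDiff_sdiff_eq_of_subset hNM, hω], ⟨hF1, ?_⟩, ⟨hF2, ?_⟩, hback ω⟩
    · show s(o, v) ∈ ω ∆ N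
      rw [Set.mem_symmDiff]; exact Or.inl ⟨he, heN⟩
    · show s(o, y) ∈ (ω ∆ N) ∆ M'
      rw [symmDiff_symmDiff_eq_of_subset hNM, Set.mem_symmDiff]; exact Or.inl ⟨hf, hfD⟩
  · -- good ↦ bad
    obtain ⟨hF, he⟩ := hA
    obtain ⟨hFB, hf⟩ := hB
    have hF' : IsForestCfg ω := hF
    have hFB' : IsForestCfg (ω ∆ M') := hFB
    obtain ⟨hF1, hF2⟩ := forest_pair_symmDiff_of_cutVertex h₁ h₂ hS hd hsub hω hF' hFB'
    have hfω : s(o, y) ∉ ω := by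
      intro h
      rw [Set.mem_setOf_eq, Set.mem_symmDiff] at hf
      rcases hf with ⟨-, h'⟩ | ⟨-, h'⟩
      · exact h' (mem_insert _ _)
      · exact h' h
    refine ⟨by rw [symmDiff_sdiff_eq_of_subset hNM, hω], ⟨hF1, ?_, ?_⟩, hF2, hback ω⟩
    · show s(o, v) ∈ ω ∆ N
      rw [Set.mem_symmDiff]; exact Or.inl ⟨he, heN⟩
    · show s(o, y) ∈ ω ∆ N
      rw [Set.mem_symmDiff]; exact Or.inr ⟨hfN, hfω⟩

end Equality

end FK

end Summit.CriticalPhenomena.PercolationContinuityZ3.Theorems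

end
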